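import Literature.NumberTheory.LFunctions.RayClassXiPair
import Literature.NumberTheory.LFunctions.RayClassGammaFactorDerivatives
import Literature.NumberTheory.LFunctions.ClassGroupPairExplicitFormula
import HarnessLib

/-!
# The explicit formula for the higher derivatives of `L'/L(s,χ) + L'/L(s,χ̄)`, Hecke characters with conductor

Topic `Literature/NumberTheory/LFunctions` (namespace `Literature.NumberTheory.LFunctions`), continuing
`RayClassXiPair.lean` (`Ξ_T = ξ_T ξ_{T̃}` symmetric entire; `Ξ'/Ξ = 2/s + 2/(s−1) + log A + 2L_∞'/L_∞ + L'/L + L''/L'`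
on `Re s > 1`), `SymmetricHadamardDerivatives.lean` (`(F'/F)^{(k)} = (−1)^k k!(2m(s−½)^{−k−1} + Σₙ Zₙ(k,s))`) and
`RayClassGammaFactorDerivatives.lean` (`(L_∞'/L_∞)^{(k)}`); the ray-class counterpart of the tree's
`ClassGroupPairExplicitFormula.lean`.  Everything here is PROVED (theorems only).

For analytic data `T = (L, L', W)` of conductor `𝔣` and sign type `p` (`RayXiData`), `D : SymmHadamardData Ξ_T`,
`Re s > 1`, `k ≥ 1`:

  `((−1)^{k+1}/k!) [ (L'/L)^{(k)}(s) + (L''/L')^{(k)}(s) ]`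
  `   = 2(s−1)^{−(k+1)} + 2s^{−(k+1)} − 2 Σ_{j≥0} a_j (s+j)^{−(k+1)} − 2m (s−½)^{−(k+1)} − Σₙ Zₙ(k,s)`

(`pairExplicitFormula`), `a_j = trivMult K p j` the multiplicities of the trivial zeros, `1/2 ± ζₙ` the zeros of
`Ξ_T`, `2m` its order at `1/2`.  This is [cite: ThornerZaman2017, Lemma 2.2] / [cite: LagariasMontgomeryOdlyzko1979,
§3 (3.5)] for the pair `χ, χ̄` of a primitive Hecke character with conductor, in exact form (all zeros, true
multiplicities, no error term), as needed by the Deuring–Heilbronn power-sum argument for congruence class groups.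

## References
* J. Thorner, A. Zaman, Algebra Number Theory 11 (2017), §2 Lemma 2.2, §7. [ThornerZaman2017]
* J. C. Lagarias, H. L. Montgomery, A. M. Odlyzko, Invent. Math. 54 (1979), §3. [LagariasMontgomeryOdlyzko1979]
-/

noncomputable section

open scoped NumberField
open Complex Filter Topology Set Metric NumberField NumberField.InfinitePlace IsDedekindDomain

namespace Literature.NumberTheory.LFunctions

open Literature.NumberTheory.LFunctions.NumberField Literature.NumberTheory.LFunctions.Stark1974
  Literature.Analysis.Complex

variable {K : Type*} [Field K] [NumberField K]
variable {𝔣 : Ideal (𝓞 K)} {p : Finset {w : InfinitePlace K // IsReal w}}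

namespace RayXiData

variable (T : RayXiData K 𝔣 p)

/-- The logarithmic derivative of an entire function is smooth at a point where the function does not vanish.
[folklore] -/
private theorem contDiffAt_logDeriv_of_ne_zero {M : ℂ → ℂ} (hM : Differentiable ℂ M) {s : ℂ} (hs : M s ≠ 0)
    (k : ℕ) : ContDiffAt ℂ k (logDeriv M) s := by
  have hV : IsOpen {z : ℂ | M z ≠ 0} := isOpen_ne_fun hM.continuous continuous_const
  have hd : DifferentiableOn ℂ (logDeriv M) {z : ℂ | M z ≠ 0} := by
    intro z hz
    have hMa : AnalyticAt ℂ M z := (hM.differentiableOn.analyticOnNhd isOpen_univ) z (Set.mem_univ _)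
    have : logDeriv M = fun w ↦ deriv M w / M w := by funext w; rw [logDeriv_apply]
    rw [this]
    exact (hMa.deriv.differentiableAt.div hMa.differentiableAt hz).differentiableWithinAt
  exact (hd.analyticAt (hV.mem_nhds hs)).contDiffAt

/-- **The explicit formula for the `k`-th derivatives of the pair `L'/L + L''/L'`** at a point with
`Re s > 1`, `k ≥ 1`:
`((−1)^{k+1}/k!)[(L'/L)^{(k)}(s) + (L''/L')^{(k)}(s)] = 2(s−1)^{−k−1} + 2s^{−k−1}
 − 2Σ_j a_j (s+j)^{−k−1} − 2m(s−½)^{−k−1} − Σₙ Zₙ(k,s)`.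
[cite: ThornerZaman2017, Lemma 2.2] [cite: LagariasMontgomeryOdlyzko1979, §3 (3.5)] -/
theorem pairExplicitFormula (D : SymmHadamardData T.xiPair) {s : ℂ} (hs : 1 < s.re) {k : ℕ} (hk : 1 ≤ k) :
    ((-1) ^ (k + 1) / k.factorial : ℂ) *
        (iteratedDeriv k (logDeriv T.L) s + iteratedDeriv k (logDeriv T.L') s) =
      2 * ((s - 1) ^ (k + 1))⁻¹ + 2 * (s ^ (k + 1))⁻¹ -
        2 * ∑' j : ℕ, (trivMult K p j : ℂ) * ((s + j) ^ (k + 1))⁻¹ -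
        (2 * D.m * ((s - 1 / 2) ^ (k + 1))⁻¹ + ∑' n, D.zeroTerm k s n) := by
  have hs0' : 0 < s.re := by linarith
  have hs0 : s ≠ 0 := fun h ↦ by rw [h, zero_re] at hs; linarith
  have hs1 : s ≠ 1 := fun h ↦ by rw [h, one_re] at hs; exact lt_irrefl _ hs
  have hU : ∀ᶠ z : ℂ in 𝓝 s, 1 < z.re := (isOpen_lt continuous_const continuous_re).mem_nhds hs
  -- the identity of functions near `s`
  have hev : (fun z ↦ logDeriv T.L z + logDeriv T.L' z) =ᶠ[𝓝 s] fun z ↦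
      -(Real.log (rayCond K 𝔣) : ℂ) + (logDeriv T.xiPair z - (2 / z + 2 / (z - 1)) -
        2 * logDeriv (rayClassGammaFactor K p) z) := by
    filter_upwards [hU] with z hz
    rw [T.logDeriv_xiPair hz]
    ring
  -- smoothness of the pieces at `s`
  have hL : ContDiffAt ℂ k (logDeriv T.L) s :=
    contDiffAt_logDeriv_of_ne_zero T.differentiable_L (T.L_ne_zero s hs) k
  have hL' : ContDiffAt ℂ k (logDeriv T.L') s :=
    contDiffAt_logDeriv_of_ne_zero T.differentiable_L' (T.L'_ne_zero s hs) k
  have hP : ContDiffAt ℂ k (fun z : ℂ ↦ 2 / z + 2 / (z - 1)) s := by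
    have h0 : ContDiffAt ℂ k (fun z : ℂ ↦ 2 / z) s := contDiffAt_const.div contDiffAt_id hs0
    have h1 : ContDiffAt ℂ k (fun z : ℂ ↦ 2 / (z - 1)) s :=
      contDiffAt_const.div (contDiffAt_id.sub contDiffAt_const) (sub_ne_zero.mpr hs1)
    exact h0.add h1
  have hO : IsOpen {z : ℂ | 0 < z.re} := isOpen_lt continuous_const continuous_re
  have hγ : ContDiffAt ℂ k (logDeriv (rayClassGammaFactor K p)) s := by
    have hd : DifferentiableOn ℂ (logDeriv (rayClassGammaFactor K p)) {z : ℂ | 0 < z.re} := by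
      intro z hz
      have hz' : 0 < z.re := hz
      have hγ0 : rayClassGammaFactor K p z ≠ 0 := rayClassGammaFactor_ne_zero p hz'
      have hγa : AnalyticAt ℂ (rayClassGammaFactor K p) z :=
        DifferentiableOn.analyticAt (s := {z : ℂ | 0 < z.re})
          (fun w hw ↦ (differentiableAt_rayClassGammaFactor_of_re_pos p hw).differentiableWithinAt)
          (hO.mem_nhds hz')
      have : logDeriv (rayClassGammaFactor K p) =
          fun w ↦ deriv (rayClassGammaFactor K p) w / rayClassGammaFactor K p w := by
        funext w; rw [logDeriv_apply]
      rw [this]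
      exact (hγa.deriv.differentiableAt.div hγa.differentiableAt hγ0).differentiableWithinAt
    exact (hd.analyticAt (hO.mem_nhds hs0')).contDiffAt
  have hΞne : T.xiPair s ≠ 0 := T.xiPair_ne_zero_of_one_lt_re hs
  have hΞ : ContDiffAt ℂ k (logDeriv T.xiPair) s :=
    contDiffAt_logDeriv_of_ne_zero T.differentiable_xiPair hΞne k
  -- differentiate `k` times
  have hk0 : 0 < k := hk
  have hlhs : iteratedDeriv k (fun z ↦ logDeriv T.L z + logDeriv T.L' z) s =
      iteratedDeriv k (logDeriv T.L) s + iteratedDeriv k (logDeriv T.L') s := iteratedDeriv_fun_add hL hL'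
  have hrhs : iteratedDeriv k (fun z ↦ -(Real.log (rayCond K 𝔣) : ℂ) + (logDeriv T.xiPair z -
      (2 / z + 2 / (z - 1)) - 2 * logDeriv (rayClassGammaFactor K p) z)) s =
      iteratedDeriv k (logDeriv T.xiPair) s - iteratedDeriv k (fun z : ℂ ↦ 2 / z + 2 / (z - 1)) s -
        2 * iteratedDeriv k (logDeriv (rayClassGammaFactor K p)) s := by
    have h1 : ContDiffAt ℂ k (fun z ↦ logDeriv T.xiPair z - (2 / z + 2 / (z - 1))) s := hΞ.sub hP
    rw [iteratedDeriv_const_add hk0, iteratedDeriv_fun_sub h1 (contDiffAt_const.mul hγ),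
      iteratedDeriv_const_mul _ hγ, iteratedDeriv_fun_sub hΞ hP]
  have hmain := hev.iteratedDeriv_eq (n := k)
  rw [hlhs, hrhs, iteratedDeriv_poleTerms hs0 hs1,
    D.iteratedDeriv_logDeriv_eq T.differentiable_xiPair hΞne k] at hmain
  have hG := (hasSum_iteratedDeriv_logDeriv_rayClassGammaFactor p hs0' hk).tsum_eq.symm
  rw [hmain, hG]
  have hsumG : ∑' j : ℕ, (-1) ^ (k + 1) * (k.factorial : ℂ) * (trivMult K p j : ℂ) * ((s + j) ^ (k + 1))⁻¹ =
      (-1) ^ (k + 1) * (k.factorial : ℂ) * ∑' j : ℕ, (trivMult K p j : ℂ) * ((s + j) ^ (k + 1))⁻¹ := by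
    rw [← tsum_mul_left]; exact tsum_congr fun j ↦ by ring
  rw [hsumG]
  set G : ℂ := ∑' j : ℕ, (trivMult K p j : ℂ) * ((s + j) ^ (k + 1))⁻¹ with hGdef
  set Z : ℂ := 2 * D.m * ((s - 1 / 2) ^ (k + 1))⁻¹ + ∑' n, D.zeroTerm k s n with hZ
  set A : ℂ := (s ^ (k + 1))⁻¹ with hA
  set B : ℂ := ((s - 1) ^ (k + 1))⁻¹ with hB
  have hfac : (k.factorial : ℂ) ≠ 0 := by exact_mod_cast k.factorial_ne_zero
  have hinv : (k.factorial : ℂ) * (k.factorial : ℂ)⁻¹ = 1 := mul_inv_cancel₀ hfac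
  have hε : ((-1 : ℂ) ^ k) * (-1) ^ k = 1 := by rw [← mul_pow]; simp
  have e1 : ((-1 : ℂ) ^ (k + 1)) = -(-1) ^ k := by rw [pow_succ, mul_neg_one]
  rw [e1, div_eq_mul_inv]
  linear_combination ((k.factorial : ℂ) * (k.factorial : ℂ)⁻¹ * (-Z + 2 * A + 2 * B - 2 * G)) * hε +
    (-Z + 2 * A + 2 * B - 2 * G) * hinv

end RayXiData

end Literature.NumberTheory.LFunctions

end
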